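import Summits.CriticalPhenomena.SAWScalingLimit.Theorems.SAWDevelopingMapHexConjectureRestrictionCocycleWindowTransport
import HarnessLib

/-!
# Crux `HexConjecture` (stmt-CriticalPhenomena-0808), line `root-locality-replaces-loewner`:
the floor-ratio profile is attained UNIFORMLY over lattice floor windows

Landing target:
`Summits/CriticalPhenomena/SAWScalingLimit/Theorems/SAWDevelopingMapHexConjectureWindowRatioUniform.lean`
(`--supports stmt-CriticalPhenomena-0808`; lead continuation prover-line-stmt-CriticalPhenomena-0808-c6-0).

The c6 reshape of the bootstrap ("the floor-ratio limit supplies the window gain") uses the single-domain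
floor-ratio transport `Z_{Λδ}(a δ, e δ)/Z_{Λδ}(a δ, b δ) → G(t)` along EVERY admissible floor family
`e δ → a + t` (hypothesis `hG`; `G(t) = exp((5/8) Re(Ls(t) − Lb)) = |Ψ'(a+t)/Ψ'(b)|^{5/8}`).  Because the
family is arbitrary, the limit is attained UNIFORMLY over the lattice floor points `t_d = s_{x + d e₀}` whose
scaled offset `δ d` lies in a compact window `[u, v] ⊂ (0, ρ₁/4)`: eventually along `δ → 0⁺`, for every such `d`
with `t_d` a boundary mid-edge of `Λ δ` reachable from `a δ = s_x`,
`|Z_{Λδ}(a δ, t_d)/Z_{Λδ}(a δ, b δ) − G(δ d)| ≤ ε₀` (`ratio_uniform_window`).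
Proof: if not, choice functions and `exists_seq_of_not_eventually` give `δ_k → 0⁺` and offsets `d_k` with
`δ_k d_k ∈ [u, v]` violating the bound; a subsequence of `δ_k d_k` converges to some `t̄ ∈ [u, v]`; gluing the
lattice points `t_{d_k}` along that subsequence with the standard approximants (`floorData`) of `a + t̄`
elsewhere gives an admissible floor family `e → a + t̄` (`tendsto_piecewise_range`), so the ratio tends to
`G(t̄)` along it, while `G(δ_k d_k) → G(t̄)` by continuity of `G` — contradiction.  (Same device as the
window maximiser argument of `windowLowerBound`, …RestrictionCocycleWindowBounds.lean, p123193.)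
-/

noncomputable section

open scoped BigOperators Topology NNReal ENNReal Classical
open Filter Set MeasureTheory Metric
open Literature.Probability.LatticeModels (HexVertex hexGraph hexCenter Site)
open Literature.Probability.RandomPlanarGeometry
open Literature.Probability.RandomPlanarGeometry.SAW
open UpperHalfPlane (upperHalfPlaneSet)

namespace Summit.CriticalPhenomena.SAWScalingLimit.Theorems.HexConjecture.RootLocality

open Summit.CriticalPhenomena.SAWScalingLimit.Theorems.ObservableToSLE.FloorRatio

/-! ### Choice from the failure of an eventual universal statement -/

/-- If `∀ x y, P δ x y` fails to hold eventually, there are choice functions along which `P` fails to hold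
eventually. [folklore] -/
theorem exists_fun_of_not_eventually {α β : Type*} [Nonempty α] [Nonempty β] {l : Filter ℝ}
    {P : ℝ → α → β → Prop} (h : ¬ ∀ᶠ δ in l, ∀ x y, P δ x y) :
    ∃ (f : ℝ → α) (g : ℝ → β), ¬ ∀ᶠ δ in l, P δ (f δ) (g δ) := by
  classical
  by_contra hcon
  push Not at hcon
  set f : ℝ → α := fun δ => if hδ : ∃ x y, ¬ P δ x y then hδ.choose else Classical.arbitrary α with hf
  set g : ℝ → β := fun δ => if hδ : ∃ x y, ¬ P δ x y then hδ.choose_spec.choose else Classical.arbitrary β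
    with hg
  apply h
  filter_upwards [hcon f g] with δ hδ
  by_contra hxy
  push Not at hxy
  obtain ⟨x, y, hxy⟩ := hxy
  have hex : ∃ x y, ¬ P δ x y := ⟨x, y, hxy⟩
  have hfδ : f δ = hex.choose := by simp only [hf, dif_pos hex]
  have hgδ : g δ = hex.choose_spec.choose := by simp only [hg, dif_pos hex]
  have := hex.choose_spec.choose_spec
  rw [← hgδ, ← hfδ] at this
  exact this hδ

/-! ### Uniform attainment of the floor-ratio profile over a window -/

/-- **The floor-ratio profile is attained uniformly over lattice floor windows.**  See the module docstring.
Hypotheses: the admissibility clause of the mechanism stub (nested families, exact rows in the rigid balls),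
`δ·mid(a δ) → a`, `δ·mid(b δ) → b`, a radius `ρ₁ ≤ ρ`, a profile `G` continuous on `(0, ρ₁)` attained along
every admissible floor family (`hG`), a compact window `0 < u ≤ v < ρ₁/4` and `ε₀ > 0`.
[cite: LawlerSchrammWerner2004SAW, §3.4 ("SAW satisfies restriction") and Prop. 2] -/
theorem ratio_uniform_window (D D' : DobrushinDomain) (ρ : ℝ) (Λ Λ' : ℝ → Finset HexVertex) (m : ℝ → ℤ)
    (a b : ℝ → Sym2 HexVertex) (hρ : 0 < ρ)
    (hev : ∀ᶠ δ : ℝ in 𝓝[>] 0,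
      Λ' δ ⊆ Λ δ ∧ hexDomainSimplyConnected (Λ δ) ∧ hexDomainSimplyConnected (Λ' δ) ∧
      (hexGraph.induce (↑(Λ δ) : Set HexVertex)).Preconnected ∧
      (hexGraph.induce (↑(Λ' δ) : Set HexVertex)).Preconnected ∧
      a δ ∈ hexDomainBoundary (Λ δ) ∧ b δ ∈ hexDomainBoundary (Λ δ) ∧
      a δ ∈ hexDomainBoundary (Λ' δ) ∧ b δ ∈ hexDomainBoundary (Λ' δ) ∧
      Nonempty (HexMidEdgeSAW (Λ' δ) (a δ) (b δ)) ∧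
      (∀ v ∈ Λ δ, (δ : ℂ) * hexCenter v ∈ D.carrier ∧ m δ ≤ v.1 1) ∧
      (∀ v ∈ Λ' δ, (δ : ℂ) * hexCenter v ∈ D'.carrier) ∧
      (∀ v : HexVertex, (δ : ℂ) * hexCenter v ∈ ball (D.pt 0) ρ ∪ ball (D.pt 1) ρ →
        ((v ∈ Λ δ ↔ m δ ≤ v.1 1) ∧ (v ∈ Λ' δ ↔ m δ ≤ v.1 1))))
    (ha : Tendsto (fun δ : ℝ => (δ : ℂ) * hexMidpoint (a δ)) (𝓝[>] 0) (𝓝 (D.pt 0)))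
    (hb : Tendsto (fun δ : ℝ => (δ : ℂ) * hexMidpoint (b δ)) (𝓝[>] 0) (𝓝 (D.pt 1)))
    {ρ₁ : ℝ} (hρ₁ρ : ρ₁ ≤ ρ) {G : ℝ → ℝ} (hGc : ContinuousOn G (Set.Ioo 0 ρ₁))
    (hG : ∀ (e : ℝ → Sym2 HexVertex) (t : ℝ), 0 < t → t ≤ ρ₁ / 4 →
      Tendsto (fun δ : ℝ => (δ : ℂ) * hexMidpoint (e δ)) (𝓝[>] 0) (𝓝 (D.pt 0 + t)) →
      (∀ᶠ δ : ℝ in 𝓝[>] 0, e δ ∈ hexDomainBoundary (Λ δ) ∧ Nonempty (HexMidEdgeSAW (Λ δ) (a δ) (e δ)) ∧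
        ∃ x yy : Site 2, a δ = s((x - Pi.single 1 1, 1), (x, 0)) ∧
          e δ = s((yy - Pi.single 1 1, 1), (yy, 0)) ∧ yy 1 = x 1 ∧ yy ≠ x) →
      Tendsto (fun δ : ℝ =>
        (∑ γ : HexMidEdgeSAW (Λ δ) (a δ) (e δ), hexCriticalFugacity ^ γ.length) /
          (∑ γ : HexMidEdgeSAW (Λ δ) (a δ) (b δ), hexCriticalFugacity ^ γ.length)) (𝓝[>] 0) (𝓝 (G t)))
    {u v : ℝ} (hu : 0 < u) (huv : u ≤ v) (hv : v < ρ₁ / 4) {ε₀ : ℝ} (hε₀ : 0 < ε₀) :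
    ∀ᶠ δ : ℝ in 𝓝[>] 0, ∀ (x : Site 2) (d : ℤ), a δ = s((x - Pi.single 1 1, 1), (x, 0)) →
      u ≤ δ * d → δ * d ≤ v →
      s((x + Pi.single 0 d - Pi.single 1 1, 1), (x + Pi.single 0 d, 0)) ∈ hexDomainBoundary (Λ δ) →
      Nonempty (HexMidEdgeSAW (Λ δ) (a δ) s((x + Pi.single 0 d - Pi.single 1 1, 1), (x + Pi.single 0 d, 0))) →
      |(∑ γ : HexMidEdgeSAW (Λ δ) (a δ) s((x + Pi.single 0 d - Pi.single 1 1, 1), (x + Pi.single 0 d, 0)),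
          hexCriticalFugacity ^ γ.length) /
        (∑ γ : HexMidEdgeSAW (Λ δ) (a δ) (b δ), hexCriticalFugacity ^ γ.length) - G (δ * d)| ≤ ε₀ := by
  by_contra hcon
  obtain ⟨xf, df, hcon'⟩ := exists_fun_of_not_eventually hcon
  obtain ⟨w, hw, hw'⟩ := exists_seq_of_not_eventually hcon' (univ_mem' fun _ => trivial)
  clear hcon hcon'
  have hw0 : ∀ k, 0 < w k := fun k => (hw' k).2.2
  -- unpack the failure along the sequence
  have hfail : ∀ k, a (w k) = s((xf (w k) - Pi.single 1 1, 1), (xf (w k), 0)) ∧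
      u ≤ w k * df (w k) ∧ w k * df (w k) ≤ v ∧
      s((xf (w k) + Pi.single 0 (df (w k)) - Pi.single 1 1, 1), (xf (w k) + Pi.single 0 (df (w k)), 0)) ∈
        hexDomainBoundary (Λ (w k)) ∧
      Nonempty (HexMidEdgeSAW (Λ (w k)) (a (w k))
        s((xf (w k) + Pi.single 0 (df (w k)) - Pi.single 1 1, 1), (xf (w k) + Pi.single 0 (df (w k)), 0))) ∧
      ε₀ < |(∑ γ : HexMidEdgeSAW (Λ (w k)) (a (w k))
          s((xf (w k) + Pi.single 0 (df (w k)) - Pi.single 1 1, 1), (xf (w k) + Pi.single 0 (df (w k)), 0)),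
          hexCriticalFugacity ^ γ.length) /
        (∑ γ : HexMidEdgeSAW (Λ (w k)) (a (w k)) (b (w k)), hexCriticalFugacity ^ γ.length) -
          G (w k * df (w k))| := by
    intro k
    have h := (hw' k).1
    push Not at h
    obtain ⟨h1, h2, h3, h4, h5, h6⟩ := h
    exact ⟨h1, h2, h3, h4, h5, h6⟩
  -- a convergent subsequence of the scaled offsets
  have hτmem : ∀ k, w k * (df (w k) : ℝ) ∈ Icc u v := fun k => ⟨(hfail k).2.1, (hfail k).2.2.1⟩
  obtain ⟨tbar, htbar, φs, hφs, hτlim⟩ := tendsto_subseq_of_bounded (isBounded_Icc u v) hτmem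
  rw [closure_Icc] at htbar
  have htbar0 : 0 < tbar := lt_of_lt_of_le hu htbar.1
  have htbar4 : tbar < ρ₁ / 4 := lt_of_le_of_lt htbar.2 hv
  have htbarρ₁ : tbar < ρ₁ := by linarith
  -- the standard approximants of `a + tbar` (off the sequence)
  have hdist : dist (D.pt 0 + (tbar : ℂ)) (D.pt 0) = tbar := by
    rw [dist_eq_norm, add_sub_cancel_left, Complex.norm_real, Real.norm_eq_abs, abs_of_pos htbar0]
  obtain ⟨sE, _, hsE, hevF⟩ := floorData D D' ρ Λ Λ' m a b hρ hev ha hb (s := D.pt 0 + (tbar : ℂ))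
    (pt_add_ne htbar0) (by simp) (by rw [hdist]; linarith) (K := 1 / 16) (by norm_num) (by rw [hdist]; linarith)
  -- the glued family
  have hv0 : ∀ k, 0 < (w ∘ φs) k := fun k => hw0 _
  have hvlim : Tendsto (w ∘ φs) atTop (𝓝[>] 0) := hw.comp hφs.tendsto_atTop
  set e : ℝ → Sym2 HexVertex := fun δ => if δ ∈ Set.range (w ∘ φs) then
    s((xf δ + Pi.single 0 (df δ) - Pi.single 1 1, 1), (xf δ + Pi.single 0 (df δ), 0)) else sE δ with he
  -- its limit
  have helim : Tendsto (fun δ : ℝ => (δ : ℂ) * hexMidpoint (e δ)) (𝓝[>] 0) (𝓝 (D.pt 0 + tbar)) := by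
    have hglue := tendsto_piecewise_range hv0
      (g := fun δ => (δ : ℂ) * hexMidpoint
        s((xf δ + Pi.single 0 (df δ) - Pi.single 1 1, 1), (xf δ + Pi.single 0 (df δ), 0)))
      (h := fun δ => (δ : ℂ) * hexMidpoint (sE δ)) (z := D.pt 0 + tbar) ?_ hsE
    · refine hglue.congr fun δ => ?_
      simp only [he]
      split_ifs <;> rfl
    have hfun : ∀ k : ℕ, ((w (φs k) : ℝ) : ℂ) * hexMidpoint (a (w (φs k))) +
        (((w (φs k) : ℝ) * ((df (w (φs k)) : ℤ) : ℝ) : ℝ) : ℂ) =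
        ((w (φs k) : ℝ) : ℂ) * hexMidpoint
          s((xf (w (φs k)) + Pi.single 0 (df (w (φs k))) - Pi.single 1 1, 1),
            (xf (w (φs k)) + Pi.single 0 (df (w (φs k))), 0)) := by
      intro k
      rw [smul_hexMidpoint_offset, (hfail (φs k)).1]
    have h1 : Tendsto (fun k => ((w (φs k) : ℝ) : ℂ) * hexMidpoint (a (w (φs k)))) atTop (𝓝 (D.pt 0)) :=
      ha.comp hvlim
    have h2 : Tendsto (fun k => (((w (φs k) : ℝ) * ((df (w (φs k)) : ℤ) : ℝ) : ℝ) : ℂ)) atTop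
        (𝓝 (tbar : ℂ)) :=
      (Complex.continuous_ofReal.tendsto _).comp hτlim
    exact (h1.add h2).congr hfun
  -- its admissibility (eventually, both branches)
  have heE : ∀ᶠ δ : ℝ in 𝓝[>] 0, e δ ∈ hexDomainBoundary (Λ δ) ∧ Nonempty (HexMidEdgeSAW (Λ δ) (a δ) (e δ)) ∧
      ∃ x yy : Site 2, a δ = s((x - Pi.single 1 1, 1), (x, 0)) ∧
        e δ = s((yy - Pi.single 1 1, 1), (yy, 0)) ∧ yy 1 = x 1 ∧ yy ≠ x := by
    filter_upwards [hevF, self_mem_nhdsWithin] with δ hF hδpos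
    by_cases hmem : δ ∈ Set.range (w ∘ φs)
    · have heδ : e δ = s((xf δ + Pi.single 0 (df δ) - Pi.single 1 1, 1), (xf δ + Pi.single 0 (df δ), 0)) := by
        simp only [he, if_pos hmem]
      obtain ⟨k, rfl⟩ := hmem
      obtain ⟨hax, hud, -, hbd, hne, -⟩ := hfail (φs k)
      have hd0 : 0 < df (w (φs k)) := by
        have hδ0 : (0 : ℝ) < w (φs k) := hw0 _
        have : (0 : ℝ) < w (φs k) * df (w (φs k)) := lt_of_lt_of_le hu hud
        exact_mod_cast pos_of_mul_pos_right this hδ0.le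
      rw [heδ]
      exact ⟨hbd, hne, xf (w (φs k)), xf (w (φs k)) + Pi.single 0 (df (w (φs k))), hax, rfl,
        offsetCell_apply_one _ _, offsetCell_ne _ hd0.ne'⟩
    · have heδ : e δ = sE δ := by simp only [he, if_neg hmem]
      obtain ⟨x, -, yy, hx1, -, hyy1, -, hyyx, hax, -, hsEx, -, -, -, hsEbd, -, -, hne, -, -⟩ := hF
      rw [heδ]
      exact ⟨hsEbd, hne, x, yy, hax, hsEx, hyy1.trans hx1.symm, hyyx⟩
  -- transport along the glued family, then along the subsequence
  have hGe := hG e tbar htbar0 htbar4.le helim heE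
  have hGv : Tendsto (fun k => (∑ γ : HexMidEdgeSAW (Λ (w (φs k))) (a (w (φs k))) (e (w (φs k))),
        hexCriticalFugacity ^ γ.length) /
      (∑ γ : HexMidEdgeSAW (Λ (w (φs k))) (a (w (φs k))) (b (w (φs k))), hexCriticalFugacity ^ γ.length))
      atTop (𝓝 (G tbar)) := hGe.comp hvlim
  -- continuity of `G` along the scaled offsets
  have hGτ : Tendsto (fun k => G (w (φs k) * df (w (φs k)))) atTop (𝓝 (G tbar)) := by
    have hct : ContinuousAt G tbar := hGc.continuousAt (Ioo_mem_nhds htbar0 htbarρ₁)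
    exact hct.tendsto.comp hτlim
  have hdiff := hGv.sub hGτ
  rw [sub_self] at hdiff
  have hsmall := (Metric.tendsto_nhds.1 hdiff) ε₀ hε₀
  obtain ⟨k, hk⟩ := hsmall.exists
  -- at `δ = w (φs k)`: contradiction
  have hmem : w (φs k) ∈ Set.range (w ∘ φs) := ⟨k, rfl⟩
  have heδ : e (w (φs k)) = s((xf (w (φs k)) + Pi.single 0 (df (w (φs k))) - Pi.single 1 1, 1),
      (xf (w (φs k)) + Pi.single 0 (df (w (φs k))), 0)) := by simp only [he, if_pos hmem]
  rw [Real.dist_eq, sub_zero, heδ] at hk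
  exact absurd hk (not_lt.2 (hfail (φs k)).2.2.2.2.2.le)

/-! ### Registered form -/

/-- **Registered sub-goal `stub_existsFunOfNotEventually`** (crux item stmt-CriticalPhenomena-0808, line
`root-locality-replaces-loewner`, lead continuation c6): choice functions from the failure of an eventual
universal statement (`exists_fun_of_not_eventually`). [folklore] -/
theorem stub_existsFunOfNotEventually : ∀ {α β : Type} [Nonempty α] [Nonempty β] (l : Filter ℝ) (P : ℝ → α → β → Prop), (¬ ∀ᶠ δ in l, ∀ x y, P δ x y) → ∃ (f : ℝ → α) (g : ℝ → β), ¬ ∀ᶠ δ in l, P δ (f δ) (g δ) :=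
  fun _ _ h => exists_fun_of_not_eventually h

end Summit.CriticalPhenomena.SAWScalingLimit.Theorems.HexConjecture.RootLocality

end
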